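import Summits.RiemannHypothesis.RiemannHypothesis.Theorems.PfPersistenceJointReaders
import HarnessLib

/-!
# Binder-generic in-window dial matching (typer gen 9, same-day verdict V1 for cand-5 C5-N8)

**HONEST FRAMING. This is a long-odds MECHANISM SEARCH; no RH claims.** RH-free typing.

The closure word `InWindowSectorDialMatchingAt` (`PfPersistenceJointReaders`) binds its atoms to PRIMES
(`pk.1.Prime`). As cand-5 (gen 5) observed and the typer confirmed, primality is a SIDE CONDITION there: the wall
`SectorFactorsThrough.not_sectorSeparates_of_inWindow` uses it only to place the multi-dial record in the domain.
This file files the BINDER-GENERIC word `InWindowSectorDialMatchingAtP P` (atoms `n` with `P n`; `P = Nat.Prime`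
recovers the old word definitionally, `P = IsPrimePow` admits EULER-FACTOR dials — all powers `p^j ≤ e^{2a}` co-scaled),
the same three-line wall for it, and the fact that the ARITHMETIC sector domain (records of tables supported on prime
powers) contains the multi-dial records of `ζ` for EVERY atom list, so that on that domain the domain hypothesis is
discharged for every `P`. Consequence: cand-5's Euler-factor Newton–Kantorovich certificates instantiate a typed word
literally (with `P = IsPrimePow`, or `P = fun _ => True`), not only in the single-atom regime.
-/

set_option linter.dupNamespace false

namespace Summit.RiemannHypothesis.RiemannHypothesis.Theorems.PfPersistence

open Matrix

/-! ## §1 The arithmetic sector domain (multi-dials preserve arithmetic support with NO primality hypothesis: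
`multiDial_mem_arithWeights`, `PfPersistenceHeightLocality`) -/

/-- the ARITHMETIC SECTOR DOMAIN for a kernel family `Θs`: multi-sector records of tables supported on prime powers
(the sector form of `arithDialSpace`). [folklore] -/
def sectorArithDialSpace {ι : Type} (Θs : ι → ℝ → ℕ → ℕ → ℝ → ℝ) : Set (SectorDatum ι) :=
  sectorDatumOf Θs '' arithWeights

/-- PROVED: `ζ`'s record is in the arithmetic sector domain. [folklore] -/
theorem sectorDatumOf_zeta_mem_sectorArithDialSpace {ι : Type} (Θs : ι → ℝ → ℕ → ℕ → ℝ → ℝ) :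
    sectorDatumOf Θs zetaWeights ∈ sectorArithDialSpace Θs :=
  ⟨_, zetaWeights_mem_arithWeights, rfl⟩

/-- PROVED: every multi-dial record of `ζ` is in the arithmetic sector domain — for EVERY atom list. [folklore] -/
theorem sectorDatumOf_multiDial_zeta_mem_sectorArithDialSpace {ι : Type} (Θs : ι → ℝ → ℕ → ℕ → ℝ → ℝ)
    (L : List (ℕ × ℝ)) : sectorDatumOf Θs (multiDial L zetaWeights) ∈ sectorArithDialSpace Θs :=
  ⟨_, multiDial_mem_arithWeights zetaWeights_mem_arithWeights, rfl⟩

/-! ## §2 The binder-generic word and its wall -/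

/-- **TYPED — IN-WINDOW DIAL MATCHING AT `win` WITH ATOM PREDICATE `P` (multi-sector):** a NONEMPTY composite of dials
at atoms `n` with `P n` INSIDE `win` (`log n < 2a`) applied to `ζ` reads exactly like `ζ` under `F`, changes the record
AT `win`, and is form-negative AT `win` in sector `i₀`. `P = Nat.Prime` is `InWindowSectorDialMatchingAt`;
`P = IsPrimePow` admits Euler-factor dials. [folklore] -/
def InWindowSectorDialMatchingAtP {ι ρ : Type} (P : ℕ → Prop) (Θs : ι → ℝ → ℕ → ℕ → ℝ → ℝ) (i₀ : ι) (win : Window)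
    (F : SectorDatum ι → ρ) : Prop :=
  ∃ L : List (ℕ × ℝ), L ≠ [] ∧ (∀ pk ∈ L, P pk.1 ∧ Real.log pk.1 < 2 * win.a) ∧
    F (sectorDatumOf Θs (multiDial L zetaWeights)) = F (sectorDatumOf Θs zetaWeights) ∧
    sectorDatumOf Θs (multiDial L zetaWeights) win ≠ sectorDatumOf Θs zetaWeights win ∧
    ∃ v : Fin (win.N + 1) → ℝ, v ⬝ᵥ (sectorDatumOf Θs (multiDial L zetaWeights) win i₀ *ᵥ v) < 0

/-- PROVED: the prime instance IS the old word (definitionally). [folklore] -/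
theorem inWindowSectorDialMatchingAtP_prime_iff {ι ρ : Type} (Θs : ι → ℝ → ℕ → ℕ → ℝ → ℝ) (i₀ : ι) (win : Window)
    (F : SectorDatum ι → ρ) :
    InWindowSectorDialMatchingAtP Nat.Prime Θs i₀ win F ↔ InWindowSectorDialMatchingAt Θs i₀ win F :=
  Iff.rfl

/-- PROVED: the word is monotone in the atom predicate (primes ⊆ prime powers ⊆ everything). [folklore] -/
theorem InWindowSectorDialMatchingAtP.mono {ι ρ : Type} {P Q : ℕ → Prop} (hPQ : ∀ n, P n → Q n)
    {Θs : ι → ℝ → ℕ → ℕ → ℝ → ℝ} {i₀ : ι} {win : Window} {F : SectorDatum ι → ρ}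
    (h : InWindowSectorDialMatchingAtP P Θs i₀ win F) : InWindowSectorDialMatchingAtP Q Θs i₀ win F := by
  obtain ⟨L, hL0, hL, hF, hne, v, hv⟩ := h
  exact ⟨L, hL0, fun pk hpk => ⟨hPQ _ (hL pk hpk).1, (hL pk hpk).2⟩, hF, hne, v, hv⟩

/-- PROVED: a prime matching is a prime-power matching. [folklore] -/
theorem InWindowSectorDialMatchingAt.isPrimePow {ι ρ : Type} {Θs : ι → ℝ → ℕ → ℕ → ℝ → ℝ} {i₀ : ι} {win : Window}
    {F : SectorDatum ι → ρ} (h : InWindowSectorDialMatchingAt Θs i₀ win F) :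
    InWindowSectorDialMatchingAtP IsPrimePow Θs i₀ win F :=
  InWindowSectorDialMatchingAtP.mono (fun _ hp => hp.isPrimePow) ((inWindowSectorDialMatchingAtP_prime_iff Θs i₀ win F).2 h)

/-- **PROVED — a `P`-matching closes every class factoring through the reader**, on any domain containing the
`P`-multi-dial records of `ζ` (the same three lines as the prime wall). [folklore] -/
theorem SectorFactorsThrough.not_sectorSeparates_of_inWindowP {ι ρ : Type} {P : ℕ → Prop}
    {Θs : ι → ℝ → ℕ → ℕ → ℝ → ℝ} {i₀ : ι} {win : Window} {F : SectorDatum ι → ρ} {S Dm : Set (SectorDatum ι)}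
    (hS : SectorFactorsThrough S F) (hM : InWindowSectorDialMatchingAtP P Θs i₀ win F)
    (hD : ∀ L : List (ℕ × ℝ), (∀ pk ∈ L, P pk.1) → sectorDatumOf Θs (multiDial L zetaWeights) ∈ Dm) :
    ¬ SectorSeparates S Dm (sectorDatumOf Θs zetaWeights) := by
  rintro ⟨hζ, hsep⟩
  obtain ⟨L, -, hL, hF, -, v, hv⟩ := hM
  exact hsep _ (hD L fun pk hpk => (hL pk hpk).1) ⟨win, i₀, v, hv⟩ ((hS _ _ hF).2 hζ)

/-- **PROVED — on the ARITHMETIC SECTOR DOMAIN the domain hypothesis is free:** a `P`-matching, for ANY `P`, closes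
every class factoring through the reader on `sectorArithDialSpace Θs` (and on every larger domain). [folklore] -/
theorem SectorFactorsThrough.not_sectorSeparates_arith_of_inWindowP {ι ρ : Type} {P : ℕ → Prop}
    {Θs : ι → ℝ → ℕ → ℕ → ℝ → ℝ} {i₀ : ι} {win : Window} {F : SectorDatum ι → ρ} {S Dm : Set (SectorDatum ι)}
    (hS : SectorFactorsThrough S F) (hM : InWindowSectorDialMatchingAtP P Θs i₀ win F)
    (hDm : sectorArithDialSpace Θs ⊆ Dm) : ¬ SectorSeparates S Dm (sectorDatumOf Θs zetaWeights) :=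
  hS.not_sectorSeparates_of_inWindowP hM fun L _ => hDm (sectorDatumOf_multiDial_zeta_mem_sectorArithDialSpace Θs L)

/-- PROVED: in particular the PRIME word closes factoring classes on the arithmetic sector domain with no domain
hypothesis left to check. [folklore] -/
theorem SectorFactorsThrough.not_sectorSeparates_arith_of_inWindow {ι ρ : Type}
    {Θs : ι → ℝ → ℕ → ℕ → ℝ → ℝ} {i₀ : ι} {win : Window} {F : SectorDatum ι → ρ} {S Dm : Set (SectorDatum ι)}
    (hS : SectorFactorsThrough S F) (hM : InWindowSectorDialMatchingAt Θs i₀ win F)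
    (hDm : sectorArithDialSpace Θs ⊆ Dm) : ¬ SectorSeparates S Dm (sectorDatumOf Θs zetaWeights) :=
  hS.not_sectorSeparates_arith_of_inWindowP ((inWindowSectorDialMatchingAtP_prime_iff Θs i₀ win F).2 hM) hDm

end Summit.RiemannHypothesis.RiemannHypothesis.Theorems.PfPersistence
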